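import Summits.BirchSwinnertonDyer.BirchSwinnertonDyer.Theorems.MordellShaFreeCutThreeAdicExistenceFromPrint
import Summits.BirchSwinnertonDyer.BirchSwinnertonDyer.Theorems.MordellShaFreeCutThreeAdicBDPExistsValueResidual
import Summits.BirchSwinnertonDyer.BirchSwinnertonDyer.Theorems.MordellShaFreeCutAssembly
import HarnessLib

set_option linter.dupNamespace false
set_option autoImplicit false

/-! # Route `MordellShaFreeCut` (rung S2b) — CRUX A and the LEAF with the EXISTENCE HALF FROM PRINT: crux A
`RankPosOfThreeSelmerCorankOne` (stmt-BirchSwinnertonDyer-19159, registered line `heegner-field-bdp-triple` v6bq) ⟸ (res) +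
{(T1), Tate–Sen, BDP13} [citation-borne] + (LB-bdp) [WRITTEN] + (LB-wan) [OPEN] + five refereed facts

Cell `bsd-cn100`, prover seat `bsd-cn100-s2b-c3` (g8). Supports, does not close, stmt-BirchSwinnertonDyer-19159 (crux A) —
serves its registered stub `stub_threeAdicBDPElementExistsWithValue` (EV∃), whose EXISTENCE half this seat made citation-borne at
the road's own Heegner fields (`MordellShaFreeCutThreeAdicExistenceFromPrint`, p489731: (LB-exist) at odd `d_K` ⟸ (T1) Hsieh
2014 Thm A + `TateSenCharacterVanishing 3` + `bertoliniDarmonPrasanna2013_centralValue_reciprocity`). THEOREMS ONLY. WHY ODD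
`d_K` SUFFICES for crux A as well: its plumbing descends to a Heegner field chosen by Hoffstein–Luo with `d_K ≡ 1 (mod 8)`
(`exists_heegnerField_descent_of_selmerCorank_eq_one`).
* §1 `heegnerPoint_not_isOfFinAddOrderOddDisc_of_corankLinkA_of_existsOddDisc_of_value_of_wan` — p479411's corank plumbing
  with the binder `Odd d_K`, EV∃'s single `obtain` split into existence-odd + (LB-bdp) ∀-frame.
* §2 `rankPosOddDisc_minimal_…` and **`cruxA_of_res_of_anyLevel_of_tateSen_of_bdp2013_of_value_of_wan`** — crux A ⟸ (res)
  [registered `stub_threeLocNonDegeneracy`, verbatim] + three printed named facts + (LB-bdp) + (LB-wan) + five refereed facts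
  (`3`-parity, modularity, Hoffstein–Luo, Kato, Heegner points); Link A (corank) is the tree theorem
  `threeAdicControlOfCorankOne_of_locNonDegeneracy`.
* §3 **`leaf_of_res_of_anyLevel_of_tateSen_of_bdp2013_of_value_of_wan`** — the rung-S2b leaf
  `rankOne_threeConverse_mordellCurve` ⟸ the same + Gross–Zagier–Kolyvagin, via the route's Assembly and p489731's crux-B census.
NET: on the registered v6bq line {RI5, (res), EV∃, (LB-wan)} the EV∃ stub's existence half is citation-borne; what remains
research on the BDP road of S2b is {(res), (LB-bdp) value formula at 𝟙, (LB-wan)} (and (LB-wan) ↔ (ERL₃) on the joined road,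
`MordellShaFreeCutRoadsMeetFromPrint`). HONEST FRAMING: CONDITIONAL theorems over named facts; nothing here proves (res),
(LB-bdp), (LB-wan), crux A/B, the leaf, Sylvester's conjecture or any case of BSD. PARTITION: none — RANK axis.
[cite: CastellaGrossiLeeSkinner2022, §5.2] [cite: Skinner2020, Thm. B and §2.2–2.3 (shape of (res))]
[cite: BertoliniDarmonPrasanna2013, Thm. 5.5] [cite: Hsieh2014, Thm. A] [cite: BrinonConrad2009, Thm. 2.2.7] -/

noncomputable section

open scoped NumberField Classical

open PowerSeries WeierstrassCurve NumberField IsDedekindDomain Field Literature.NumberTheory.EllipticCurves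
  Literature.NumberTheory.EllipticCurves.ModularForms Literature.NumberTheory.QuadraticFields
  Literature.NumberTheory.EllipticCurves.Castella2018
open Literature.NumberTheory.GaloisRepresentations Literature.NumberTheory.GaloisCohomology
open Literature.NumberTheory.PAdicHodge (TateSenCharacterVanishing)
open Summit.BirchSwinnertonDyer.BirchSwinnertonDyer.Theses.MordellShaFreeCut
open Summit.BirchSwinnertonDyer.BirchSwinnertonDyer.Theorems.MordellShaFreeCutThreeAdicLinksCorank
  (ThreeAdicControlOfCorankOne)
open Summit.BirchSwinnertonDyer.BirchSwinnertonDyer.Theorems.MordellShaFreeCutThreeAdicBDPTriple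
  (ThreeAdicWanDivisibility ThreeAdicBDPValueAtOne)
open Summit.BirchSwinnertonDyer.BirchSwinnertonDyer.Theorems.MordellShaFreeCutResidualCensusPTFree
  (threeAdicControlOfCorankOne_of_locNonDegeneracy)
open Summit.BirchSwinnertonDyer.BirchSwinnertonDyer.Theorems.MordellShaFreeCutThreeAdicExistenceFromPrint
  (threeAdicBDPElementExistsOddDisc_of_anyLevel_of_tateSen_of_bdp2013 cruxB_of_anyLevel_of_tateSen_of_bdp2013_of_value_of_wan)

namespace Summit.BirchSwinnertonDyer.BirchSwinnertonDyer.Theorems.MordellShaFreeCutResidualExistenceFromPrint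

/-! ## §1 Corank-currency plumbing at ODD `d_K` -/

/-- **Corank-currency plumbing at ODD `d_K`** (p479411's `heegnerPoint_not_isOfFinAddOrder_of_corankLinkA_of_bdpExistsValue`
with the binder `Odd d_K` and EV∃'s `obtain` split into existence-odd `hE` + the ∀-frame value formula `hV`): Link A in corank
form + (LB-exist)-odd + (LB-bdp) + (LB-wan) force every Heegner point at a corank-one datum over a Heegner field of odd
discriminant to be non-torsion. CONDITIONAL; credits nothing. [cite: CastellaGrossiLeeSkinner2022, §5.2 (proof of Thm. 5.2.1)]
[cite: Castella2018, proof of Thm. 2.3 with Thm. 3.4 (shape)] [cite: SilvermanAEC2009, IV.6.4 and VII.2.2] -/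
theorem heegnerPoint_not_isOfFinAddOrderOddDisc_of_corankLinkA_of_existsOddDisc_of_value_of_wan
    (hAc : ThreeAdicControlOfCorankOne)
    (hE : ∀ (W : WeierstrassCurve ℚ) [W.IsElliptic] [W.IsGloballyMinimal], W.j = 0 →
      ∀ (K : Type) [Field K] [NumberField K] (N : ℕ) [NeZero N]
        (Dt : ModularParametrizationData W N)
        (v : HeightOneSpectrum (𝓞 K)) (κ : ZpExtension K 3) (γ : absoluteGaloisGroup K)
        [Fact (κ.IsTopGenerator γ)],
      W.conductorNorm ℤ = N → IsImaginaryQuadratic K → Odd (NumberField.discr K) →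
      SatisfiesHeegnerHypothesis N K → ((Ideal.span {(3 : ℤ)}).primesOver (𝓞 K)).ncard = 2 →
      ((3 : ℕ) : 𝓞 K) ∈ v.asIdeal → κ.IsAnticyclotomic →
      ∃ ι' : PadicAlgCl 3 ≃+* ℂ,
        (∀ (w : InfinitePlace K) (k : 𝓞 K), k ∈ v.asIdeal ↔ ‖ι'.symm (w.embedding (k : K))‖ < 1) ∧
        ∃ (ΩK : ℂ) (Ωp : (unrIntegers 3)ˣ) (L : UnrSeries 3),
          ΩK ≠ 0 ∧ IsBDPLFunction ι' v κ γ Dt.f ΩK ((Ωp : unrIntegers 3) : ℂ_[3]) L)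
    (hV : ThreeAdicBDPValueAtOne) (hWan : ThreeAdicWanDivisibility) :
    ∀ (W : WeierstrassCurve ℚ) [W.IsElliptic] [W.IsGloballyMinimal], W.j = 0 →
      ∀ (K : Type) [Field K] [NumberField K] (N : ℕ) [NeZero N], W.conductorNorm ℤ = N →
        IsImaginaryQuadratic K → Odd (NumberField.discr K) →
          SatisfiesHeegnerHypothesis N K → SatisfiesHeegnerHypothesis 3 K →
          (W.baseChange K).selmerCorank 3 = 1 →
            ∀ (P : (W.baseChange K).toAffine.Point), IsHeegnerPoint N W K P → ¬ IsOfFinAddOrder P := by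
  intro W _ _ hj K _ _ N _ hN hK hodd hHN hH3 hcK P hP hPtor
  haveI : Fact (Nat.Prime 3) := ⟨Nat.prime_three⟩
  have hsplit : ((Ideal.span {(3 : ℤ)}).primesOver (𝓞 K)).ncard = 2 :=
    hH3 3 Nat.prime_three (dvd_refl 3)
  -- (1) the anticyclotomic datum, THE embedding at a degree-one `v ∣ 3`, the partner `v̄`
  obtain ⟨κ, γ, v, hκ, hγ, hv3, he, hf⟩ :=
    Summit.BirchSwinnertonDyer.Rank1Residual.X11b.exists_anticyclotomic_generator_degreeOnePrime 3 K hK hH3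
  haveI : Fact (κ.IsTopGenerator γ) := ⟨hγ⟩
  set ι : K →+* ℚ_[3] := Summit.BirchSwinnertonDyer.Rank1Residual.X11b.embAt K 3 v hv3 he hf with hιdef
  have hv : ∀ x : 𝓞 K, x ∈ v.asIdeal ↔ ‖ι (x : K)‖ < 1 :=
    Summit.BirchSwinnertonDyer.Rank1Residual.X11b.mem_asIdeal_iff_norm_embAt_lt_one v hv3 he hf
  obtain ⟨vbar, hvbar, hne⟩ :=
    Summit.BirchSwinnertonDyer.Rank1Residual.X11b.exists_other_prime hH3 v hv3
  -- (2) Link A (corank form): a generator `F` of `char_Λ 𝔛` with `F(0) ≠ 0`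
  obtain ⟨m, hm⟩ := hAc W hj K N hN hK hHN hH3 ι v vbar hv hvbar hne κ hκ γ hcK
  obtain ⟨-, F, hF, hF0, -⟩ := hm
  have hFmem : F ∈ AcSelmer.XAc.charIdeal (W.baseChange K) 3 κ vbar ∅ γ := by
    rw [hF]; exact Ideal.mem_span_singleton_self F
  -- (3) the Heegner point data; its Galois conjugate readable at an infinite place
  obtain ⟨Dt, H, ιK, hPK⟩ := hP
  obtain ⟨w₀⟩ := (inferInstance : Nonempty (InfinitePlace K))
  haveI : IsGalois ℚ K := by
    haveI : Algebra.IsQuadraticExtension ℚ K := ⟨hK.1⟩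
    infer_instance
  obtain ⟨σ, hσ⟩ := NumberField.ComplexEmbedding.exists_comp_symm_eq_of_comp_eq (k := ℚ)
    w₀.embedding ιK (by ext x; simp)
  set τ : K →+* K := ((σ.symm : K ≃ₐ[ℚ] K) : K →+* K) with hτdef
  set P' := WeierstrassCurve.Affine.Point.map τ.toRatAlgHom P with hP'def
  have hP' : WeierstrassCurve.Affine.Point.map w₀.embedding.toRatAlgHom P' =
      heegnerPointComplex Dt H := by
    rw [hP'def, WeierstrassCurve.Affine.Point.map_map]
    have hcomp : w₀.embedding.toRatAlgHom.comp τ.toRatAlgHom = ιK.toRatAlgHom := by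
      apply AlgHom.ext
      intro x
      have := RingHom.congr_fun hσ x
      simpa [hτdef] using this
    rw [hcomp]
    exact hPK
  have hP'tor : IsOfFinAddOrder P' := by
    rw [hP'def]; exact AddMonoidHom.isOfFinAddOrder _ hPtor
  -- (4) existence at the ODD-discriminant datum (from print) + the ∀-frame value formula at the reading `P'`
  obtain ⟨ι', hι', ΩK, Ωp, L, hΩK, hBDP⟩ := hE W hj K N Dt v κ γ hN hK hodd hHN hsplit hv3 hκ
  obtain ⟨u, hu⟩ := hV W hj ι' K N Dt H w₀ ι v κ γ P' hN hK hHN hsplit hv3 hι' hκ hP' hv ΩK Ωp L hΩK hBDP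
  -- (5) (LB-wan) along `toUnr : ℤ₃ → R₀`
  obtain ⟨k, hk⟩ := hWan W hj ι' K N Dt v vbar κ γ hN hK hHN hsplit hι' hvbar hne hκ ΩK Ωp L hΩK hBDP
    (Summit.BirchSwinnertonDyer.Rank1Residual.X11b.Halves.toUnr 3)
    (Summit.BirchSwinnertonDyer.Rank1Residual.X11b.Halves.coe_toUnr 3)
  set F' : IwasawaAlgebra 3 := C ((3 : ℤ_[3]) ^ k) * F with hF'def
  have hF'0 : constantCoeff F' ≠ 0 := by
    rw [hF'def, map_mul, PowerSeries.constantCoeff_C]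
    exact mul_ne_zero (pow_ne_zero _ (by norm_num)) hF0
  have hfL : PowerSeries.map (Summit.BirchSwinnertonDyer.Rank1Residual.X11b.Halves.toUnr 3) F' ∈
      Ideal.span {L} := by
    have hmap : PowerSeries.map (Summit.BirchSwinnertonDyer.Rank1Residual.X11b.Halves.toUnr 3) F' =
        C ((3 : unrIntegers 3) ^ k) *
          PowerSeries.map (Summit.BirchSwinnertonDyer.Rank1Residual.X11b.Halves.toUnr 3) F := by
      rw [hF'def, map_mul, PowerSeries.map_C, map_pow, map_ofNat]
    rw [hmap]
    exact hk F hFmem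
  -- (6) the value at `𝟙` in the shape of the halves algebra
  set x : ℚ_[3] := (Dt.c : ℚ_[3])⁻¹ *
      (1 - (W.LFunction 3 : ℚ_[3]) * (3 : ℚ_[3])⁻¹ + (if (3 : ℕ) ∣ N then 0 else (3 : ℚ_[3])⁻¹)) *
      padicLogOmega W 3 ι P' with hxdef
  have hshape : ((Dt.c : ℚ_[3])⁻¹) ^ 2 *
      (1 - (W.LFunction 3 : ℚ_[3]) * (3 : ℚ_[3])⁻¹ + (if (3 : ℕ) ∣ N then 0 else (3 : ℚ_[3])⁻¹)) ^ 2 *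
      (padicLogOmega W 3 ι P') ^ 2 =
      (((1 : ℚ_[3]) - ((0 : ℤ) : ℚ_[3]) * ((3 : ℕ) : ℚ_[3])⁻¹) * x) ^ 2 := by
    rw [hxdef]; push_cast; ring
  rw [hshape, map_pow] at hu
  -- (7) the algebra of halves: `x ≠ 0`, hence `log_ω P' ≠ 0`; a torsion point has zero logarithm
  obtain ⟨hx0, -⟩ :=
    Summit.BirchSwinnertonDyer.Rank1Residual.X11b.Halves.two_mul_sub_one_le_valuation 3 hF'0 hfL u 0 hu
  apply hx0
  rw [hxdef]
  unfold padicLogOmega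
  rw [AcPConverseLinks.padicLogPoint_formalIndex_smul_eq_zero_of_isOfFinAddOrder W 3 ι hP'tor, zero_div,
    mul_zero]

/-! ## §2 Crux A with the existence half from print -/

/-- **Globally minimal `j = 0` case of crux A at the data of the road**: descend to a Heegner field with `d_K ≡ 1 (mod 8)`
(`exists_heegnerField_descent_of_selmerCorank_eq_one`), take a Heegner point, apply the ODD-`d_K` corank plumbing,
Mordell–Weil. CONDITIONAL; credits nothing. [cite: CastellaGrossiLeeSkinner2022, §5.2 (proof of Thm. 5.2.1)]
[cite: HoffsteinLuo1997, Theorem (§1)] -/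
theorem rankPosOddDisc_minimal_of_corankLinkA_of_existsOddDisc_of_value_of_wan
    (hpar : ∀ (W : WeierstrassCurve ℚ) [W.IsElliptic] (p : ℕ) [Fact p.Prime], p_parity W p)
    (hmod : ModularForms.exists_isNewformOf) (hHL : HoffsteinLuo1997_exists_twist_L_one_ne_zero)
    (hKato : ∀ (W : WeierstrassCurve ℚ) [W.IsElliptic] (p : ℕ) [Fact p.Prime],
      kato_finite_of_L_one_ne_zero W p)
    (hHP : ∀ (W : WeierstrassCurve ℚ) (K : Type) [Field K] [NumberField K],
      exists_isHeegnerPoint W K)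
    (hAc : ThreeAdicControlOfCorankOne)
    (hE : ∀ (W : WeierstrassCurve ℚ) [W.IsElliptic] [W.IsGloballyMinimal], W.j = 0 →
      ∀ (K : Type) [Field K] [NumberField K] (N : ℕ) [NeZero N]
        (Dt : ModularParametrizationData W N)
        (v : HeightOneSpectrum (𝓞 K)) (κ : ZpExtension K 3) (γ : absoluteGaloisGroup K)
        [Fact (κ.IsTopGenerator γ)],
      W.conductorNorm ℤ = N → IsImaginaryQuadratic K → Odd (NumberField.discr K) →
      SatisfiesHeegnerHypothesis N K → ((Ideal.span {(3 : ℤ)}).primesOver (𝓞 K)).ncard = 2 →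
      ((3 : ℕ) : 𝓞 K) ∈ v.asIdeal → κ.IsAnticyclotomic →
      ∃ ι' : PadicAlgCl 3 ≃+* ℂ,
        (∀ (w : InfinitePlace K) (k : 𝓞 K), k ∈ v.asIdeal ↔ ‖ι'.symm (w.embedding (k : K))‖ < 1) ∧
        ∃ (ΩK : ℂ) (Ωp : (unrIntegers 3)ˣ) (L : UnrSeries 3),
          ΩK ≠ 0 ∧ IsBDPLFunction ι' v κ γ Dt.f ΩK ((Ωp : unrIntegers 3) : ℂ_[3]) L)
    (hV : ThreeAdicBDPValueAtOne) (hWan : ThreeAdicWanDivisibility) :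
    ∀ (W : WeierstrassCurve ℚ) [W.IsElliptic] [W.IsGloballyMinimal], W.j = 0 →
      W.selmerCorank 3 = 1 → 1 ≤ W.mordellWeilRank := by
  intro W _ _ hj hc
  haveI : Fact (Nat.Prime 3) := ⟨Nat.prime_three⟩
  haveI : NeZero (W.conductorNorm ℤ) := ⟨(W.conductorNorm_pos_holds).ne'⟩
  obtain ⟨K, _, _, hK, -, hHN, hH3, h8, -, hcK, hrk, -⟩ :=
    exists_heegnerField_descent_of_selmerCorank_eq_one hpar hmod hHL hKato W 3 hc 0
  have hodd : Odd (NumberField.discr K) := Int.odd_iff.mpr (by omega)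
  obtain ⟨P, hP⟩ := hHP W K hK hHN
  have hPnt : ¬ IsOfFinAddOrder P :=
    heegnerPoint_not_isOfFinAddOrderOddDisc_of_corankLinkA_of_existsOddDisc_of_value_of_wan hAc hE hV hWan W hj K
      (W.conductorNorm ℤ) rfl hK hodd hHN hH3 hcK P hP
  have hrkK : 1 ≤ (W.baseChange K).mordellWeilRank :=
    one_le_mordellWeilRank_of_not_isOfFinAddOrder _ (W.baseChange K).module_finite_point_holds hPnt
  rwa [hrk] at hrkK

/-- **Crux A `RankPosOfThreeSelmerCorankOne` ⟸ (res) at `3` (the registered `stub_threeLocNonDegeneracy`, verbatim) + THREE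
PRINTED NAMED FACTS {(T1) `Hsieh2014.thmA_exists_isHsiehLFunction_unrPeriod_anyLevel`, `TateSenCharacterVanishing 3`,
`bertoliniDarmonPrasanna2013_centralValue_reciprocity`} + (LB-bdp) ∀-frame `ThreeAdicBDPValueAtOne` [WRITTEN] + (LB-wan)
`ThreeAdicWanDivisibility` [OPEN] + five refereed facts** (`3`-parity, modularity, Hoffstein–Luo, Kato, Heegner points). Link
A in corank form is the tree theorem `threeAdicControlOfCorankOne_of_locNonDegeneracy hres` (p457636); existence-odd is
`threeAdicBDPElementExistsOddDisc_of_anyLevel_of_tateSen_of_bdp2013` (p489731); then the minimal-model reduction as in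
p479411. CONDITIONAL; credits nothing. [cite: SilvermanAEC2009, III.3.1(b) and VIII.8]
[cite: Skinner2020, Thm. B and §2.2–2.3 (shape of (res))] [cite: BertoliniDarmonPrasanna2013, Thm. 5.5 and (5.1.16) (p. 60)] -/
theorem cruxA_of_res_of_anyLevel_of_tateSen_of_bdp2013_of_value_of_wan
    (hpar : ∀ (W : WeierstrassCurve ℚ) [W.IsElliptic] (p : ℕ) [Fact p.Prime], p_parity W p)
    (hmod : ModularForms.exists_isNewformOf) (hHL : HoffsteinLuo1997_exists_twist_L_one_ne_zero)
    (hKato : ∀ (W : WeierstrassCurve ℚ) [W.IsElliptic] (p : ℕ) [Fact p.Prime],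
      kato_finite_of_L_one_ne_zero W p)
    (hHP : ∀ (W : WeierstrassCurve ℚ) (K : Type) [Field K] [NumberField K],
      exists_isHeegnerPoint W K)
    (hres : ∀ (W : WeierstrassCurve ℚ) [W.IsElliptic] [W.IsGloballyMinimal], W.j = 0 →
      ∀ (K : Type) [Field K] [NumberField K],
      IsImaginaryQuadratic K → SatisfiesHeegnerHypothesis 3 K →
        (W.baseChange K).selmerCorank 3 = 1 →
      ∀ (w : HeightOneSpectrum (𝓞 K)), ((3 : ℕ) : 𝓞 K) ∈ w.asIdeal →
        Finite ↥((W.baseChange K).selmerGroupPInfty 3 ⊓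
          selmerLocalKerPrimaryTorsion (W.baseChange K) (w.adicCompletion K) 3))
    (hT1 : Hsieh2014.thmA_exists_isHsiehLFunction_unrPeriod_anyLevel) (hTS : TateSenCharacterVanishing 3)
    (hBDP : bertoliniDarmonPrasanna2013_centralValue_reciprocity)
    (hV : ThreeAdicBDPValueAtOne) (hWan : ThreeAdicWanDivisibility) :
    RankPosOfThreeSelmerCorankOne := by
  intro D hD hc
  haveI := isElliptic_mordellCurve hD
  haveI : Fact (Nat.Prime 3) := ⟨Nat.prime_three⟩
  obtain ⟨C, hmin⟩ := hasGlobalMinimalModel_rat_holds (mordellCurve D)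
  haveI : (C • mordellCurve D).IsGloballyMinimal := hmin
  have hj : (C • mordellCurve D).j = 0 := by
    rw [variableChange_j]; exact (mordellCurve D).j_eq_zero (mordellCurve_c₄ _)
  have hc' : (C • mordellCurve D).selmerCorank 3 = 1 := by
    rw [← selmerCorank_eq_of_variableChange 3 (rfl : C • mordellCurve D = C • mordellCurve D)]
    exact hc
  have h1 := rankPosOddDisc_minimal_of_corankLinkA_of_existsOddDisc_of_value_of_wan hpar hmod hHL hKato hHP
    (threeAdicControlOfCorankOne_of_locNonDegeneracy hres)
    (threeAdicBDPElementExistsOddDisc_of_anyLevel_of_tateSen_of_bdp2013 hT1 hTS hBDP) hV hWan (C • mordellCurve D) hj hc'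
  rwa [mordellWeilRank_variableChange_holds] at h1

/-! ## §3 The route's leaf with the existence half from print -/

/-- **THE ROUTE'S KERNEL CENSUS with the existence half from print: the rung-S2b leaf `rankOne_threeConverse_mordellCurve` ⟸
{(res) at `3`, (LB-bdp) ∀-frame value formula, (LB-wan)} + THREE PRINTED NAMED FACTS {(T1), Tate–Sen, BDP13} + six refereed
facts** (`3`-parity, modularity, Hoffstein–Luo, Kato, Gross 1984, Gross–Zagier + Kolyvagin) — the route's Assembly
(`MordellShaFreeCutAssembly.assembly_holds`) of `cruxA_of_res_of_anyLevel_of_tateSen_of_bdp2013_of_value_of_wan` and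
`cruxB_of_anyLevel_of_tateSen_of_bdp2013_of_value_of_wan` (p489731). Research content of the route on the BDP road after this
file: ONE Selmer-only statement (res) + ONE value formula at 𝟙 + ONE main-conjecture divisibility, all at the additive prime
`3`; NO construction / descent statement. CONDITIONAL; neither BSD nor Sylvester's conjecture is touched.
[cite: GrossZagier1986, Thm. I.6.3 with V.§2] [cite: CastellaGrossiLeeSkinner2022, §5.2 (proof of Thm. 5.2.1)]
[cite: BertoliniDarmonPrasanna2013, Thm. 5.5 and (5.1.16) (p. 60)] -/
theorem leaf_of_res_of_anyLevel_of_tateSen_of_bdp2013_of_value_of_wan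
    (hpar : ∀ (W : WeierstrassCurve ℚ) [W.IsElliptic] (p : ℕ) [Fact p.Prime], p_parity W p)
    (hmod : ModularForms.exists_isNewformOf) (hHL : HoffsteinLuo1997_exists_twist_L_one_ne_zero)
    (hKato : ∀ (W : WeierstrassCurve ℚ) [W.IsElliptic] (p : ℕ) [Fact p.Prime],
      kato_finite_of_L_one_ne_zero W p)
    (hHP : ∀ (W : WeierstrassCurve ℚ) (K : Type) [Field K] [NumberField K],
      exists_isHeegnerPoint W K)
    (hGZ : ∀ (W : WeierstrassCurve ℚ) (N : ℕ) [NeZero N] (K : Type) [Field K] [NumberField K],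
      analyticRankEK_eq_one_iff_heegner_nonTorsion W N K)
    (hres : ∀ (W : WeierstrassCurve ℚ) [W.IsElliptic] [W.IsGloballyMinimal], W.j = 0 →
      ∀ (K : Type) [Field K] [NumberField K],
      IsImaginaryQuadratic K → SatisfiesHeegnerHypothesis 3 K →
        (W.baseChange K).selmerCorank 3 = 1 →
      ∀ (w : HeightOneSpectrum (𝓞 K)), ((3 : ℕ) : 𝓞 K) ∈ w.asIdeal →
        Finite ↥((W.baseChange K).selmerGroupPInfty 3 ⊓
          selmerLocalKerPrimaryTorsion (W.baseChange K) (w.adicCompletion K) 3))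
    (hT1 : Hsieh2014.thmA_exists_isHsiehLFunction_unrPeriod_anyLevel) (hTS : TateSenCharacterVanishing 3)
    (hBDP : bertoliniDarmonPrasanna2013_centralValue_reciprocity)
    (hV : ThreeAdicBDPValueAtOne) (hWan : ThreeAdicWanDivisibility) :
    rankOne_threeConverse_mordellCurve :=
  MordellShaFreeCutAssembly.assembly_holds
    (cruxA_of_res_of_anyLevel_of_tateSen_of_bdp2013_of_value_of_wan hpar hmod hHL hKato hHP hres hT1 hTS hBDP hV hWan)
    (cruxB_of_anyLevel_of_tateSen_of_bdp2013_of_value_of_wan hpar hmod hHL hKato hHP hGZ hT1 hTS hBDP hV hWan)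

end Summit.BirchSwinnertonDyer.BirchSwinnertonDyer.Theorems.MordellShaFreeCutResidualExistenceFromPrint

end
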